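import Summits.QuantumFields.YangMills.Theorems.BalabanUVNodesN12TowerForestWords
import HarnessLib

/-!
# BalabanUVNodes ∕ N12 — THE RANKED TOWER FOREST: the least root level and the parent step of `N12TowerForest.exists_towerForest` EXPORTED, and the root of a site read off its path
# (a site and its parent have the same root) — the generic half of «the root of every site is the centre of its least rooted block» (dag-n12-w6's Q2-DESIGN §1∕§8 reading of the
# forest: «roots = block CENTRES», «the tower forest hangs `B^{j−1}(p̃)` from `p` and the rest of `B^j(x)` from `r`»; the `𝐁_k(Z)`-geometry half is `…N12BjCollarRoots`)

Cell `pub-ymgap` (HUMAN RULINGS D-0062 ∕ D-0149), WIDTH SEAT `pub-ymgap-dag-n12-w3` g3 (node N12 = [B15]; key K1⁹ `stmt-QuantumFields-27364` (KEY MAP v2), `--kind proof --supports … --as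
helper`; count-neutral).  THEOREMS ONLY (0 `def`, 0 `instance`, 0 `sorry`); consumed BY NAME: this seat's `N12TowerForest.exists_forest_of_rankedParents` ∕ `exists_parent_toward_centre`
(p626341), `N12RootedForest.forest_F1` (p618645), `N12RootedForestGeodesic.tdist_embIter_iterBlockOf_le` (p623006), n07's `N07CritMultiScaleLamBond.iterBlockOf_congr_of_le`,
`T4Continuum.walk` ∕ `walkEnd`.

CONTENTS.  §1 `root_eq_of_walk` (if `p = walk r (letters p)` ends at `x` then `r` is `x` for `p = []`, else the start of the first step), ★ `root_eq_root_of_parent` (`path x = path x′ ++ [s]`,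
`s` from `x′` to `x`, both paths walks of their words from `r`, `r′` ⇒ `r = r′`).  §2 ★★ `exists_towerForest_ranked` (under (Cov): `path` and `n_z ≤ k` — `ι_{n_z}(B^{n_z} z) ∈ R(𝐁,k)`,
`n_z ≤ j` for every rooted level `j ≤ k` — with (F1), (F2) (member and root-set forms), (PAR) every non-root `x` hangs by its last oriented step from a parent `x′` in the same `j`-block
for every rooted level `j` of `x`, `n_{x′} ≤ n_x`, `tdist x′ c + 1 = tdist x c` for the centre `c` of the `n_x`-block, (TOWER), (LEN)).

HONEST FRAMING.  Lattice bookkeeping; no analysis; nothing of Bałaban's asserted; N12 NOT discharged; K1⁹ NOT closed; counts unmoved (typed 28∕28 · discharged 5∕27); one finite 𝕋⁴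
programme at fixed ε — R4 closes the conditional rung `BalabanLadder.UV` only; the Yang–Mills mass gap (Clay) is NOT proved by any of this; nothing continuum ∕ ℝ⁴ ∕ OS.
-/

noncomputable section

namespace Summit.QuantumFields.YangMills.BalabanUVNodes.N12TowerForestRanked

open scoped BigOperators
open Literature.MathematicalPhysics.QuantumFieldTheory.Balaban1983to89
open T4Continuum
open B15DeterminingSets
open B5Eq118OneStroke (iterBlockOf)
open Summit.QuantumFields.YangMills.BalabanUVNodes.N12RootedForest (forest_F1)
open Summit.QuantumFields.YangMills.BalabanUVNodes.N12RootedForestGeodesic (tdist_embIter_iterBlockOf_le)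
open Summit.QuantumFields.YangMills.BalabanUVNodes.N12TowerForest (exists_forest_of_rankedParents exists_parent_toward_centre)
open Summit.QuantumFields.YangMills.BalabanUVNodes.N07CritMultiScaleLamBond (iterBlockOf_congr_of_le)

variable {P : Params}

/-! ## §1 The root of a site is the start of its path; a site and its parent have the same root -/

section RootStart

variable {j : ℕ}

/-- **THE ROOT IS READ OFF THE PATH**: if `p = walk r (p.map letters)` ends at `x`, then `r` is `x` when `p = []`, else the START of the first step of `p` (its source if traversed forward,
its target if backward). [cite: Balaban1985RegularSpaces, (1.19) p.79 (the tree; bookkeeping)] -/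
theorem root_eq_of_walk {r x : Site P j} {p : List (LStep P j)} (hwalk : p = walk r (p.map fun s => (s.bond.dir, s.fwd)))
    (hend : walkEnd r (p.map fun s => (s.bond.dir, s.fwd)) = x) :
    r = (match p with | [] => x | s :: _ => if s.fwd then s.bond.src else s.bond.tgt) := by
  cases p with
  | nil => show r = x; exact hend
  | cons s t =>
    obtain ⟨⟨src, dir⟩, fwd⟩ := s
    cases fwd
    · simp only [List.map_cons, walk, List.cons.injEq] at hwalk
      have hsrc : src = r.unshift dir := by
        have := congrArg (fun u : LStep P j => u.bond.src) hwalk.1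
        simpa using this
      show r = (⟨src, dir⟩ : PBond P j).tgt
      rw [PBond.tgt, hsrc]
      exact (Site.shift_unshift r dir).symm
    · simp only [List.map_cons, walk, List.cons.injEq] at hwalk
      have hsrc : src = r := by
        have := congrArg (fun u : LStep P j => u.bond.src) hwalk.1
        simpa using this
      show r = src
      rw [hsrc]

/-- ★ **A SITE AND ITS PARENT HAVE THE SAME ROOT**: if `path x = path x′ ++ [s]` with `s` oriented from `x′` to `x`, and both paths are the walks of their letter words from `r`, `r′`
ending at `x`, `x′`, then `r = r′`. [cite: Balaban1985RegularSpaces, (1.19) p.79 (the tree; bookkeeping)] -/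
theorem root_eq_root_of_parent {path : Site P j → List (LStep P j)} {x x' r r' : Site P j} {s : LStep P j}
    (hpx : path x = path x' ++ [s]) (hor : (s.fwd = true → s.bond.src = x' ∧ s.bond.tgt = x) ∧ (s.fwd = false → s.bond.src = x ∧ s.bond.tgt = x'))
    (hwalk : path x = walk r ((path x).map fun s => (s.bond.dir, s.fwd))) (hend : walkEnd r ((path x).map fun s => (s.bond.dir, s.fwd)) = x)
    (hwalk' : path x' = walk r' ((path x').map fun s => (s.bond.dir, s.fwd))) (hend' : walkEnd r' ((path x').map fun s => (s.bond.dir, s.fwd)) = x') : r = r' := by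
  have h1 := root_eq_of_walk hwalk hend
  have h2 := root_eq_of_walk hwalk' hend'
  rw [hpx] at h1
  rcases hp : path x' with _ | ⟨t, rest⟩
  · rw [hp] at h1 h2
    simp only [List.nil_append] at h1
    rw [h1, h2]
    show (if s.fwd = true then s.bond.src else s.bond.tgt) = x'
    cases h : s.fwd
    · rw [if_neg Bool.false_ne_true]; exact (hor.2 h).2
    · rw [if_pos rfl]; exact (hor.1 h).1
  · rw [hp] at h1 h2
    simp only [List.cons_append] at h1
    rw [h1, h2]

end RootStart

/-! ## §2 The ranked tower forest: the least root level and the parent step, exported -/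

section Ranked

/-- ★★ **THE TOWER FOREST WITH ITS RANKING EXPORTED** (the construction of `N12TowerForest.exists_towerForest`, same witness shape, two more clauses): under (Cov) there are `path` and the
LEAST ROOT LEVEL `n_z ≤ k` of every site (`ι_{n_z}(B^{n_z} z) ∈ R(𝐁,k)` and `n_z ≤ j` for every rooted level `j ≤ k` of `z`) with (F1), (F2) (member form and root-set form), and (PAR): every
non-root `x` hangs by its last oriented step from a parent `x′` IN THE SAME `j`-BLOCK for every rooted level `j` of `x`, with `n_{x′} ≤ n_x`, ONE UNIT CLOSER (torus distance) to the centre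
of the `n_x`-block of `x`; whence (TOWER) and (LEN) as in `exists_towerForest`. [cite: Balaban1988Convergent, (2.2) p.255; Balaban1985RegularSpaces, (1.19) p.79; Balaban1987RG1, (0.1)–(0.3) pp.251–252] -/
theorem exists_towerForest_ranked (𝔹 : DetSet P) {k : ℕ} (hk : k ≤ P.m + P.K) (hcov : ∀ z : Site P 0, ∃ j, j ≤ k ∧ iterBlockOf j z ∈ 𝔹 j) :
    ∃ (path : Site P 0 → List (LStep P 0)) (nz : Site P 0 → ℕ),
      (∀ z, nz z ≤ k ∧ embIter (nz z) (iterBlockOf (nz z) z) ∈ {z : Site P 0 | ∃ j, j ≤ k ∧ ∃ c ∈ bondsOf (𝔹 j), (z = embIter j c.src ∨ z = embIter j c.tgt)} ∧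
        ∀ j, j ≤ k → embIter j (iterBlockOf j z) ∈ {z : Site P 0 | ∃ j, j ≤ k ∧ ∃ c ∈ bondsOf (𝔹 j), (z = embIter j c.src ∨ z = embIter j c.tgt)} → nz z ≤ j) ∧
      (∀ x, ∀ s ∈ path x, ∃ x' x'' : Site P 0, path x'' = path x' ++ [s] ∧
        (s.fwd = true → s.bond.src = x' ∧ s.bond.tgt = x'') ∧ (s.fwd = false → s.bond.src = x'' ∧ s.bond.tgt = x')) ∧
      (∀ j, j ≤ k → ∀ c ∈ bondsOf (𝔹 j), path (embIter j c.src) = [] ∧ path (embIter j c.tgt) = []) ∧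
      (∀ r ∈ {z : Site P 0 | ∃ j, j ≤ k ∧ ∃ c ∈ bondsOf (𝔹 j), (z = embIter j c.src ∨ z = embIter j c.tgt)}, path r = []) ∧
      (∀ x : Site P 0, x ∉ {z : Site P 0 | ∃ j, j ≤ k ∧ ∃ c ∈ bondsOf (𝔹 j), (z = embIter j c.src ∨ z = embIter j c.tgt)} →
        ∃ (x' : Site P 0) (s : LStep P 0), path x = path x' ++ [s] ∧
          ((s.fwd = true → s.bond.src = x' ∧ s.bond.tgt = x) ∧ (s.fwd = false → s.bond.src = x ∧ s.bond.tgt = x')) ∧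
          (∀ j, j ≤ k → embIter j (iterBlockOf j x) ∈ {z : Site P 0 | ∃ j, j ≤ k ∧ ∃ c ∈ bondsOf (𝔹 j), (z = embIter j c.src ∨ z = embIter j c.tgt)} →
            iterBlockOf j x' = iterBlockOf j x) ∧
          nz x' ≤ nz x ∧
          Site.tdist x' (embIter (nz x) (iterBlockOf (nz x) x)) + 1 = Site.tdist x (embIter (nz x) (iterBlockOf (nz x) x))) ∧
      (∀ (z : Site P 0) (j : ℕ), j ≤ k →
        embIter j (iterBlockOf j z) ∈ {z : Site P 0 | ∃ j, j ≤ k ∧ ∃ c ∈ bondsOf (𝔹 j), (z = embIter j c.src ∨ z = embIter j c.tgt)} →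
        ∀ s ∈ path z, iterBlockOf j s.bond.src = iterBlockOf j z ∧ iterBlockOf j s.bond.tgt = iterBlockOf j z) ∧
      (∀ (z : Site P 0) (j : ℕ), j ≤ k →
        embIter j (iterBlockOf j z) ∈ {z : Site P 0 | ∃ j, j ≤ k ∧ ∃ c ∈ bondsOf (𝔹 j), (z = embIter j c.src ∨ z = embIter j c.tgt)} →
        (path z).length ≤ ∑ i ∈ Finset.range (j + 1), (P.d * ((P.L ^ i - 1) / 2) + 1)) := by
  classical
  set R : Set (Site P 0) := {z : Site P 0 | ∃ j, j ≤ k ∧ ∃ c ∈ bondsOf (𝔹 j), (z = embIter j c.src ∨ z = embIter j c.tgt)} with hR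
  -- the least root level of the tower of a site
  have hex : ∀ z : Site P 0, ∃ n, n ≤ k ∧ embIter n (iterBlockOf n z) ∈ R := fun z => by
    obtain ⟨j, hj, hz⟩ := hcov z
    exact ⟨j, hj, j, hj, ⟨iterBlockOf j z, ⟨0, P.hd⟩⟩, Or.inl hz, Or.inl rfl⟩
  let nz : Site P 0 → ℕ := fun z => Nat.find (hex z)
  have hnz : ∀ z, nz z ≤ k ∧ embIter (nz z) (iterBlockOf (nz z) z) ∈ R := fun z => Nat.find_spec (hex z)
  have hmin : ∀ z j, j ≤ k → embIter j (iterBlockOf j z) ∈ R → nz z ≤ j := fun z j hj hmem => Nat.find_min' (hex z) ⟨hj, hmem⟩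
  -- the rank
  let S : ℕ → ℕ := fun n => ∑ i ∈ Finset.range n, (P.d * ((P.L ^ i - 1) / 2) + 1)
  have hS_succ : ∀ n, S (n + 1) = S n + (P.d * ((P.L ^ n - 1) / 2) + 1) := fun n => Finset.sum_range_succ _ n
  have hS_mono : ∀ {a b}, a ≤ b → S a ≤ S b := fun {a b} hab =>
    Finset.sum_le_sum_of_subset (Finset.range_subset_range.2 hab)
  let ρ : Site P 0 → ℕ := fun z => Site.tdist z (embIter (nz z) (iterBlockOf (nz z) z)) + S (nz z)
  have hρle : ∀ z j, j ≤ k → embIter j (iterBlockOf j z) ∈ R → ρ z + 1 ≤ S (j + 1) := fun z j hj hmem => by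
    have hn := hmin z j hj hmem
    have ht := tdist_embIter_iterBlockOf_le ((hnz z).1.trans hk) z
    have h1 : ρ z + 1 ≤ S (nz z + 1) := by
      show Site.tdist z (embIter (nz z) (iterBlockOf (nz z) z)) + S (nz z) + 1 ≤ S (nz z + 1)
      rw [hS_succ]; omega
    exact h1.trans (hS_mono (by omega))
  -- ranked parents with the edge predicate «same `j`-block for every root level `j` of the child, least root level not larger, one unit closer to the centre»
  obtain ⟨path, hroot, htree, hlen⟩ := exists_forest_of_rankedParents R ρ
    (fun x' x => (∀ j, j ≤ k → embIter j (iterBlockOf j x) ∈ R → iterBlockOf j x' = iterBlockOf j x) ∧ nz x' ≤ nz x ∧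
      Site.tdist x' (embIter (nz x) (iterBlockOf (nz x) x)) + 1 = Site.tdist x (embIter (nz x) (iterBlockOf (nz x) x))) (fun x hxR => by
      obtain ⟨hnk, hmem⟩ := hnz x
      have hne : x ≠ embIter (nz x) (iterBlockOf (nz x) x) := fun h => hxR (h ▸ hmem)
      obtain ⟨x', l, hwalk, hblk, hdist⟩ := exists_parent_toward_centre (hnk.trans hk) hne
      have hmem' : embIter (nz x) (iterBlockOf (nz x) x') ∈ R := by rw [hblk]; exact hmem
      have hn' : nz x' ≤ nz x := hmin x' (nz x) hnk hmem'
      refine ⟨x', l, ?_, hwalk, fun j hj hj' => iterBlockOf_congr_of_le (hmin x j hj hj') hblk, hn', hdist⟩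
      show Site.tdist x' (embIter (nz x') (iterBlockOf (nz x') x')) + S (nz x') < Site.tdist x (embIter (nz x) (iterBlockOf (nz x) x)) + S (nz x)
      rcases hn'.lt_or_eq with hlt | heq
      · have ht := tdist_embIter_iterBlockOf_le ((hnz x').1.trans hk) x'
        have h1 : Site.tdist x' (embIter (nz x') (iterBlockOf (nz x') x')) + S (nz x') + 1 ≤ S (nz x' + 1) := by rw [hS_succ]; omega
        have h2 : S (nz x' + 1) ≤ S (nz x) := hS_mono (by omega)
        omega
      · rw [heq, hblk]
        omega)
  refine ⟨path, nz, fun z => ⟨(hnz z).1, (hnz z).2, fun j hj hmem => hmin z j hj hmem⟩, forest_F1 hroot (fun x hx => ?_),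
    fun j hj c hc => ⟨hroot _ ⟨j, hj, c, hc, Or.inl rfl⟩, hroot _ ⟨j, hj, c, hc, Or.inr rfl⟩⟩, hroot,
    fun x hx => ?_, fun z j hj hmem => ?_, fun z j hj hmem => ?_⟩
  · obtain ⟨x', s, hpx, hor, -, -⟩ := htree x hx
    exact ⟨x', s, hpx, hor⟩
  · obtain ⟨x', s, hpx, hor, ⟨hE, hn', hdist⟩, -⟩ := htree x hx
    exact ⟨x', s, hpx, hor, hE, hn', hdist⟩
  · -- (TOWER) by induction along the path
    have key : ∀ (n : ℕ) (z : Site P 0), (path z).length = n → embIter j (iterBlockOf j z) ∈ R →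
        ∀ s ∈ path z, iterBlockOf j s.bond.src = iterBlockOf j z ∧ iterBlockOf j s.bond.tgt = iterBlockOf j z := by
      intro n
      induction' n using Nat.strong_induction_on with n ih
      intro z hn hmemz s hs
      by_cases hzR : z ∈ R
      · rw [hroot z hzR] at hs
        simp at hs
      · obtain ⟨z', t, hpz, hor, ⟨hE, -, -⟩, -⟩ := htree z hzR
        have hblk : iterBlockOf j z' = iterBlockOf j z := hE j hj hmemz
        rw [hpz, List.mem_append, List.mem_singleton] at hs
        rcases hs with hs | rfl
        · have hmemz' : embIter j (iterBlockOf j z') ∈ R := by rw [hblk]; exact hmemz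
          have hlt : (path z').length < n := by rw [← hn, hpz, List.length_append, List.length_singleton]; omega
          obtain ⟨h1, h2⟩ := ih _ hlt z' rfl hmemz' s hs
          exact ⟨h1.trans hblk, h2.trans hblk⟩
        · cases h : s.fwd
          · obtain ⟨hsrc, htgt⟩ := hor.2 h
            rw [hsrc, htgt]
            exact ⟨rfl, hblk⟩
          · obtain ⟨hsrc, htgt⟩ := hor.1 h
            rw [hsrc, htgt]
            exact ⟨hblk, rfl⟩
    exact key _ z rfl hmem
  · exact (Nat.le_succ_of_le (hlen z)).trans (hρle z j hj hmem)

end Ranked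

end Summit.QuantumFields.YangMills.BalabanUVNodes.N12TowerForestRanked

end
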